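import Summits.QuantumFields.YangMills.Theorems.LuscherReductionOneSiteLevelsValleyChartNear
import Mathlib.Analysis.InnerProductSpace.Dual

/-!
# VALLEY, step 4d: Riesz vectors for the gradient and the transverse Hessian of the one-site action; `Λ_U ≥ 2ρ(U)²`
# (support module for `stub_absUpperValleyMag` of crux `OneSiteLevels`, route `LuscherReduction`, item stmt-QuantumFields-20007;
# fleet lead prover ym-luscher-20007-p1 g2)

The NEAR Laplace estimate (`…ValleyGauss.GaussNear.integral_gaussGain_le`) is stated for a linear term `⟨g, y⟩` and a quadratic form
`Q(y) = Σ_m ⟨r_m, y⟩²` on `ZM = ℝ⁹`.  This file realises the gradient `G_U(y) = 4Σ_p c_p·ℓ_p(y)` and the transverse Hessian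
`Q_U(y) = Σ_p |ℓ_p(y)|²` of `…ValleyChartNear` in that form (`exists_riesz_near`): there are `g₀ ∈ ZM` and `r : (Fin 3 × Fin 3) × Fin 3 → ZM` with
`⟨g₀, y⟩ = G_U(y)`, `Σ_m ⟨r_m, y⟩² = Q_U(y)`, `‖g₀‖ ≤ 4√2 ρ(U) √S(U)` and — the transverse zero-point frequencies — `Σ_m ‖r_m‖² ≥ 2ρ(U)²`
(Parseval plus the Frobenius identity `Σ_a |x × M e_a|² = |x|²(2w₀² + |w⃗|²) + (x·w⃗)² ≥ |x|²` for a unit quaternion `(w₀, w⃗)`, `frobenius_linkMap`).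

## WHAT THIS IS NOT
Linear algebra only; NOT the valley estimate, NOT the crux, NOT THE CLAY GAP.  Sorry-free; no new definition, no named fact.
-/

set_option autoImplicit false

noncomputable section

open MeasureTheory Filter Topology Real
open scoped Matrix Quaternion RealInnerProductSpace BigOperators
open Literature.MathematicalPhysics.QuantumFieldTheory
open Literature.MathematicalPhysics.QuantumLattice
open Literature.Analysis.OperatorTheory.YMMatrixModel

namespace Summit.QuantumFields.YangMills.Theorems.FemtoTransferGap

/-! ### §1. The Frobenius identity for the link map -/

/-- One column of the Frobenius identity, as a sum of three squares. [folklore] -/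
theorem frobenius_linkMap_aux (x w e : Fin 3 → ℝ) (s : ℝ) :
    (x ⨯₃ (s • e + w ⨯₃ e)) ⬝ᵥ (x ⨯₃ (s • e + w ⨯₃ e))
    = (x 1 * (s * e 2 + (w 0 * e 1 - w 1 * e 0)) - x 2 * (s * e 1 + (w 2 * e 0 - w 0 * e 2))) ^ 2
      + (x 2 * (s * e 0 + (w 1 * e 2 - w 2 * e 1)) - x 0 * (s * e 2 + (w 0 * e 1 - w 1 * e 0))) ^ 2
      + (x 0 * (s * e 1 + (w 2 * e 0 - w 0 * e 2)) - x 1 * (s * e 0 + (w 1 * e 2 - w 2 * e 1))) ^ 2 := by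
  simp only [cross_apply, dotProduct, Fin.sum_univ_three, Matrix.cons_val_zero, Matrix.cons_val_one, Matrix.head_cons,
    Matrix.cons_val_two, Matrix.tail_cons, Pi.add_apply, Pi.smul_apply, smul_eq_mul]
  ring

/-- **Frobenius identity**: `Σ_a |x × (s e_a + w × e_a)|² = |x|²(2s² + |w|²) + (x·w)²`. [folklore] -/
theorem frobenius_linkMap (x w : Fin 3 → ℝ) (s : ℝ) :
    ∑ a : Fin 3, (x ⨯₃ (s • (Pi.single a 1 : Fin 3 → ℝ) + w ⨯₃ (Pi.single a 1 : Fin 3 → ℝ))) ⬝ᵥ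
      (x ⨯₃ (s • (Pi.single a 1 : Fin 3 → ℝ) + w ⨯₃ (Pi.single a 1 : Fin 3 → ℝ)))
    = (x ⬝ᵥ x) * (2 * s ^ 2 + w ⬝ᵥ w) + (x ⬝ᵥ w) ^ 2 := by
  simp only [frobenius_linkMap_aux, Fin.sum_univ_three]
  have h0 : (Pi.single (0 : Fin 3) (1 : ℝ) : Fin 3 → ℝ) 0 = 1 := by simp
  have h01 : (Pi.single (0 : Fin 3) (1 : ℝ) : Fin 3 → ℝ) 1 = 0 := by simp
  have h02 : (Pi.single (0 : Fin 3) (1 : ℝ) : Fin 3 → ℝ) 2 = 0 := by simp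
  have h10 : (Pi.single (1 : Fin 3) (1 : ℝ) : Fin 3 → ℝ) 0 = 0 := by simp
  have h11 : (Pi.single (1 : Fin 3) (1 : ℝ) : Fin 3 → ℝ) 1 = 1 := by simp
  have h12 : (Pi.single (1 : Fin 3) (1 : ℝ) : Fin 3 → ℝ) 2 = 0 := by simp
  have h20 : (Pi.single (2 : Fin 3) (1 : ℝ) : Fin 3 → ℝ) 0 = 0 := by simp
  have h21 : (Pi.single (2 : Fin 3) (1 : ℝ) : Fin 3 → ℝ) 1 = 0 := by simp
  have h22 : (Pi.single (2 : Fin 3) (1 : ℝ) : Fin 3 → ℝ) 2 = 1 := by simp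
  rw [h0, h01, h02, h10, h11, h12, h20, h21, h22]
  simp only [dotProduct, Fin.sum_univ_three]
  ring

/-- For a unit quaternion `(w₀, w⃗)`: `Σ_a |x × (w₀ e_a + w⃗ × e_a)|² ≥ |x|²`. [folklore] -/
theorem frobenius_linkMap_ge (x : Fin 3 → ℝ) (W : SU2) :
    x ⬝ᵥ x ≤ ∑ a : Fin 3, (x ⨯₃ (scalarPart W • (Pi.single a 1 : Fin 3 → ℝ) + vecPart W ⨯₃ (Pi.single a 1 : Fin 3 → ℝ))) ⬝ᵥ
      (x ⨯₃ (scalarPart W • (Pi.single a 1 : Fin 3 → ℝ) + vecPart W ⨯₃ (Pi.single a 1 : Fin 3 → ℝ))) := by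
  rw [frobenius_linkMap]
  have h1 := scalarPart_sq_add W
  rw [← vecPart_dot_self] at h1
  have hx : 0 ≤ x ⬝ᵥ x := Finset.sum_nonneg fun _ _ => mul_self_nonneg _
  nlinarith [sq_nonneg (x ⬝ᵥ vecPart W), sq_nonneg (scalarPart W), mul_nonneg hx (sq_nonneg (scalarPart W))]

/-! ### §2. The Riesz data of the gradient and the Hessian -/

/-- Colour vectors of coordinate unit vectors: `colourVec e_{(j,a)} i = [i = j] e_a`. [folklore] -/
theorem colourVec_single (j : Fin 3) (a : Fin 3) (i : Fin 3) :
    colourVec (EuclideanSpace.single (j, a) (1:ℝ)) i = if i = j then (Pi.single a 1 : Fin 3 → ℝ) else 0 := by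
  funext b
  simp only [colourVec, PiLp.single_apply, Prod.mk.injEq]
  by_cases hij : i = j
  · subst hij
    by_cases hab : b = a
    · subst hab; simp
    · simp [hab]
  · simp [hij]

/-- **Riesz data for the NEAR estimate.**  For every `U` there are `g₀ ∈ ZM` (gradient) and `r_m ∈ ZM`, `m ∈ (Fin 3 × Fin 3) × Fin 3`
(transverse Hessian) with `⟨g₀, y⟩ = 4 Σ_p c_p·ℓ_p(y)`, `Σ_m ⟨r_m,y⟩² = Σ_p |ℓ_p(y)|²`, `‖g₀‖ ≤ 4√2 ρ(U)√S(U)` and `Σ_m‖r_m‖² ≥ 2ρ(U)²`.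
[cite: SimonB1983DiscreteSpectrum, §2] -/
theorem exists_riesz_near (U : Cfg) :
    ∃ (g₀ : ZM) (r : (Fin 3 × Fin 3) × Fin 3 → ZM),
      (∀ y : ZM, ⟪g₀, y⟫ = 4 * ∑ p : Fin 3 × Fin 3, (vecPart (U (edgeOf p.1)) ⨯₃ vecPart (U (edgeOf p.2))) ⬝ᵥ
          (vecPart (U (edgeOf p.1)) ⨯₃ (scalarPart (U (edgeOf p.2)) • colourVec y p.2 + vecPart (U (edgeOf p.2)) ⨯₃ colourVec y p.2)
            + (scalarPart (U (edgeOf p.1)) • colourVec y p.1 + vecPart (U (edgeOf p.1)) ⨯₃ colourVec y p.1) ⨯₃ vecPart (U (edgeOf p.2))))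
      ∧ (∀ y : ZM, ∑ m, ⟪r m, y⟫ ^ 2 = ∑ p : Fin 3 × Fin 3,
          (vecPart (U (edgeOf p.1)) ⨯₃ (scalarPart (U (edgeOf p.2)) • colourVec y p.2 + vecPart (U (edgeOf p.2)) ⨯₃ colourVec y p.2)
            + (scalarPart (U (edgeOf p.1)) • colourVec y p.1 + vecPart (U (edgeOf p.1)) ⨯₃ colourVec y p.1) ⨯₃ vecPart (U (edgeOf p.2)))
          ⬝ᵥ (vecPart (U (edgeOf p.1)) ⨯₃ (scalarPart (U (edgeOf p.2)) • colourVec y p.2 + vecPart (U (edgeOf p.2)) ⨯₃ colourVec y p.2)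
            + (scalarPart (U (edgeOf p.1)) • colourVec y p.1 + vecPart (U (edgeOf p.1)) ⨯₃ colourVec y p.1) ⨯₃ vecPart (U (edgeOf p.2))))
      ∧ ‖g₀‖ ≤ 4 * Real.sqrt 2 * ‖zmCoord 1 U‖ * √(wilsonAction su2Rep U)
      ∧ 2 * ‖zmCoord 1 U‖ ^ 2 ≤ ∑ m, ‖r m‖ ^ 2 := by
  -- the linear maps
  let cvL : Fin 3 → (ZM →ₗ[ℝ] (Fin 3 → ℝ)) := fun j =>
    { toFun := fun y => colourVec y j, map_add' := fun y y' => rfl, map_smul' := fun c y => rfl }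
  let ML : Fin 3 → ((Fin 3 → ℝ) →ₗ[ℝ] (Fin 3 → ℝ)) := fun i =>
    scalarPart (U (edgeOf i)) • LinearMap.id + crossProduct (vecPart (U (edgeOf i)))
  let ellL : Fin 3 × Fin 3 → (ZM →ₗ[ℝ] (Fin 3 → ℝ)) := fun p =>
    (crossProduct (vecPart (U (edgeOf p.1)))).comp ((ML p.2).comp (cvL p.2))
      + (LinearMap.flip crossProduct (vecPart (U (edgeOf p.2)))).comp ((ML p.1).comp (cvL p.1))
  have hML : ∀ i (v : Fin 3 → ℝ), ML i v = scalarPart (U (edgeOf i)) • v + vecPart (U (edgeOf i)) ⨯₃ v := fun i v => by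
    simp [ML]
  have hell : ∀ p (y : ZM), ellL p y
      = vecPart (U (edgeOf p.1)) ⨯₃ (scalarPart (U (edgeOf p.2)) • colourVec y p.2 + vecPart (U (edgeOf p.2)) ⨯₃ colourVec y p.2)
        + (scalarPart (U (edgeOf p.1)) • colourVec y p.1 + vecPart (U (edgeOf p.1)) ⨯₃ colourVec y p.1) ⨯₃ vecPart (U (edgeOf p.2)) := by
    intro p y
    simp only [ellL, LinearMap.add_apply, LinearMap.comp_apply, LinearMap.flip_apply, hML]
    rfl
  -- the gradient functional
  let dotL : Fin 3 × Fin 3 → ((Fin 3 → ℝ) →ₗ[ℝ] ℝ) := fun p =>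
    { toFun := fun v => (vecPart (U (edgeOf p.1)) ⨯₃ vecPart (U (edgeOf p.2))) ⬝ᵥ v
      map_add' := fun v v' => dotProduct_add _ _ _
      map_smul' := fun c v => by simp [dotProduct_smul] }
  let GradL : ZM →ₗ[ℝ] ℝ := (4 : ℝ) • ∑ p : Fin 3 × Fin 3, (dotL p).comp (ellL p)
  have hGradL : ∀ y : ZM, GradL y = 4 * ∑ p : Fin 3 × Fin 3, (vecPart (U (edgeOf p.1)) ⨯₃ vecPart (U (edgeOf p.2))) ⬝ᵥ ellL p y := by
    intro y
    simp only [GradL, LinearMap.smul_apply, LinearMap.coe_sum, Finset.sum_apply, LinearMap.comp_apply, smul_eq_mul]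
    rfl
  -- components of the Hessian forms
  let φL : (Fin 3 × Fin 3) × Fin 3 → (ZM →ₗ[ℝ] ℝ) := fun m => (LinearMap.proj m.2).comp (ellL m.1)
  have hφL : ∀ m (y : ZM), φL m y = ellL m.1 y m.2 := fun m y => rfl
  -- Riesz vectors
  let g₀ : ZM := (InnerProductSpace.toDual ℝ ZM).symm (LinearMap.toContinuousLinearMap GradL)
  let r : (Fin 3 × Fin 3) × Fin 3 → ZM := fun m => (InnerProductSpace.toDual ℝ ZM).symm (LinearMap.toContinuousLinearMap (φL m))
  have hg₀ : ∀ y : ZM, ⟪g₀, y⟫ = GradL y := fun y => by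
    show ⟪(InnerProductSpace.toDual ℝ ZM).symm (LinearMap.toContinuousLinearMap GradL), y⟫ = GradL y
    rw [InnerProductSpace.toDual_symm_apply]; rfl
  have hr : ∀ m (y : ZM), ⟪r m, y⟫ = ellL m.1 y m.2 := fun m y => by
    show ⟪(InnerProductSpace.toDual ℝ ZM).symm (LinearMap.toContinuousLinearMap (φL m)), y⟫ = _
    rw [InnerProductSpace.toDual_symm_apply]; rfl
  refine ⟨g₀, r, fun y => ?_, fun y => ?_, ?_, ?_⟩
  · rw [hg₀, hGradL]; simp only [hell]
  · rw [Fintype.sum_prod_type]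
    refine Finset.sum_congr rfl fun p _ => ?_
    rw [← hell]
    simp only [hr, dotProduct, sq]
  · -- ‖g₀‖² = G(g₀) ≤ 4√2 ρ √S ‖g₀‖
    have hb := (step_size_bounds U g₀).1
    have hsq : ‖g₀‖ ^ 2 = GradL g₀ := by rw [← real_inner_self_eq_norm_sq, hg₀]
    rw [hGradL] at hsq
    simp only [hell] at hsq
    have h0 : 0 ≤ 4 * Real.sqrt 2 * ‖zmCoord 1 U‖ * √(wilsonAction su2Rep U) := by positivity
    by_cases hz : ‖g₀‖ = 0
    · rw [hz]; exact h0
    · have hpos : 0 < ‖g₀‖ := lt_of_le_of_ne (norm_nonneg _) (Ne.symm hz)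
      have : ‖g₀‖ ^ 2 ≤ 4 * (Real.sqrt 2 * ‖zmCoord 1 U‖ * √(wilsonAction su2Rep U) * ‖g₀‖) := by
        rw [hsq]; exact mul_le_mul_of_nonneg_left ((le_abs_self _).trans hb) (by norm_num)
      nlinarith
  · -- Parseval: Σ_m ‖r_m‖² = Σ_idx Σ_m (r_m idx)² ≥ Σ_{j,a} Σ_{i≠j} |u_i × M_j e_a|² ≥ 2ρ²
    have hnorm : ∀ m, ‖r m‖ ^ 2 = ∑ idx : Fin 3 × Fin 3, (ellL m.1 (EuclideanSpace.single idx (1:ℝ)) m.2) ^ 2 := by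
      intro m
      rw [EuclideanSpace.norm_sq_eq]
      refine Finset.sum_congr rfl fun idx _ => ?_
      rw [Real.norm_eq_abs, sq_abs]
      congr 1
      have := hr m (EuclideanSpace.single idx (1:ℝ))
      rw [EuclideanSpace.inner_single_right] at this
      simpa using this
    simp_rw [hnorm]
    rw [Finset.sum_comm]
    simp only [Fintype.sum_prod_type]
    -- now: 2ρ² ≤ Σ_j Σ_a Σ_i Σ_j' Σ_k (ellL (i,j') e_{(j,a)} k)²
    have hcv : ∀ (j a : Fin 3) (i : Fin 3), colourVec (EuclideanSpace.single (j, a) (1:ℝ)) i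
        = if i = j then (Pi.single a 1 : Fin 3 → ℝ) else 0 := fun j a i => colourVec_single j a i
    have hterm : ∀ (j a : Fin 3) (i : Fin 3), i ≠ j →
        ∑ k : Fin 3, (ellL (i, j) (EuclideanSpace.single (j, a) (1:ℝ)) k) ^ 2
          = (vecPart (U (edgeOf i)) ⨯₃ (scalarPart (U (edgeOf j)) • (Pi.single a 1 : Fin 3 → ℝ)
              + vecPart (U (edgeOf j)) ⨯₃ (Pi.single a 1 : Fin 3 → ℝ))) ⬝ᵥ
            (vecPart (U (edgeOf i)) ⨯₃ (scalarPart (U (edgeOf j)) • (Pi.single a 1 : Fin 3 → ℝ)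
              + vecPart (U (edgeOf j)) ⨯₃ (Pi.single a 1 : Fin 3 → ℝ))) := by
      intro j a i hij
      have hcj : colourVec (EuclideanSpace.single (j, a) (1:ℝ)) j = (Pi.single a 1 : Fin 3 → ℝ) := by rw [hcv, if_pos rfl]
      have hci : colourVec (EuclideanSpace.single (j, a) (1:ℝ)) i = 0 := by rw [hcv, if_neg hij]
      rw [hell]
      simp only [hcj, hci, smul_zero, map_zero, LinearMap.zero_apply, add_zero]
      rw [dotProduct, Fin.sum_univ_three, Fin.sum_univ_three]
      simp only [sq]
    calc 2 * ‖zmCoord 1 U‖ ^ 2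
        = ∑ j : Fin 3, ∑ i : Fin 3, (if i = j then 0 else vecPart (U (edgeOf i)) ⬝ᵥ vecPart (U (edgeOf i))) := by
          rw [norm_zmCoord_sq_eq_sum_dot]
          simp only [colourVec_zmCoord_one, Fin.sum_univ_three]
          simp
          ring
      _ ≤ ∑ j : Fin 3, ∑ a : Fin 3, ∑ i : Fin 3, ∑ k : Fin 3, (ellL (i, j) (EuclideanSpace.single (j, a) (1:ℝ)) k) ^ 2 := by
          refine Finset.sum_le_sum fun j _ => ?_
          calc ∑ i : Fin 3, (if i = j then 0 else vecPart (U (edgeOf i)) ⬝ᵥ vecPart (U (edgeOf i)))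
              ≤ ∑ i : Fin 3, ∑ a : Fin 3, ∑ k : Fin 3, (ellL (i, j) (EuclideanSpace.single (j, a) (1:ℝ)) k) ^ 2 := by
                refine Finset.sum_le_sum fun i _ => ?_
                by_cases hij : i = j
                · rw [if_pos hij]; exact Finset.sum_nonneg fun a _ => Finset.sum_nonneg fun k _ => sq_nonneg _
                · rw [if_neg hij]
                  simp_rw [hterm j _ i hij]
                  exact frobenius_linkMap_ge _ _
            _ = ∑ a : Fin 3, ∑ i : Fin 3, ∑ k : Fin 3, (ellL (i, j) (EuclideanSpace.single (j, a) (1:ℝ)) k) ^ 2 := Finset.sum_comm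
      _ ≤ ∑ j : Fin 3, ∑ a : Fin 3, ∑ i : Fin 3, ∑ j' : Fin 3, ∑ k : Fin 3, (ellL (i, j') (EuclideanSpace.single (j, a) (1:ℝ)) k) ^ 2 := by
          refine Finset.sum_le_sum fun j _ => Finset.sum_le_sum fun a _ => Finset.sum_le_sum fun i _ => ?_
          exact Finset.single_le_sum (f := fun j' : Fin 3 => ∑ k : Fin 3, (ellL (i, j') (EuclideanSpace.single (j, a) (1:ℝ)) k) ^ 2)
            (fun j' _ => Finset.sum_nonneg fun k _ => sq_nonneg _) (Finset.mem_univ j)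

end Summit.QuantumFields.YangMills.Theorems.FemtoTransferGap

end
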